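import Literature.Computability.QuantumComplexity.QuantumTuringProofs
import Literature.Computability.Cryptography.QuantumTuringMachinePositionedOblivious
import HarnessLib

/-!
# `BQPQTM = BQP` (quantum-advantage S04): the simulation hypothesis in Bernstein–Vazirani's positioned model

Addendum to `QuantumTuringProofs.lean` (the glue `BQPQTM_eq_BQP_of hYao hamp hNO` of
Nishimura–Ozawa 2002, Thm. 5.2, for the named fact
`Literature.Computability.QuantumComplexity.BQPQTM_eq_BQP`, and its positioned forms
`BQP_subset_BQPQTM_of_pos`, `BQPQTM_eq_BQP_of_pos`, `BQP_subset_BQPQTMPos_of`). There the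
hypothesis `hNO` (Nishimura–Ozawa's Lemma 5.1: QTMs carry out uniform circuit families exactly)
is stated with the TREE's acceptance functional `QTM.acceptProbAt`, which sums the amplitudes of
translated configurations (model caveat, `RotationWalk`). The natural home of every published
construction is Bernstein–Vazirani's positioned model (`QuantumTuringMachinePositioned.lean`:
`QTM.PIsWellFormed`, `QTM.pstateAt`, `QTM.pacceptProbAt`), and the constructions are
head-OBLIVIOUS (the head trajectory does not depend on the computation path: Bernstein–Vazirani
1997, App. B Def. B.5 and the synchronisation theorem 4.3; Nishimura–Ozawa 2002, Lemma 5.1).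
This file records, with a complete proof, that such a positioned, oblivious simulation lemma
gives both inclusions of `BQP` at once:

* `BQP_subset_BQPQTM_of_positioned` — from `hNOpos` (for every polynomial-time uniform
  oracle-free Clifford+T family: a BV-well-formed QTM with polynomial-time computable amplitudes,
  a polynomial observation time `q`, head-oblivious superpositions at the observation time, and
  positioned acceptance probability equal to the family's) one gets BOTH `BQP ⊆ BQPQTM` (tree;
  this is `BQP_subset_BQPQTM_of_pos`, via `QTM.isWellFormed_of_pIsWellFormed` and
  `QTM.acceptProbAt_eq_pacceptProbAt`) and `BQP ⊆ BQPQTMPos` (positioned;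
  `BQP_subset_BQPQTMPos_of`, forgetting head-obliviousness).

The equality `BQPQTM_eq_BQP` from `hYao`, `hamp` (as in `BQPQTM_eq_BQP_of`) and `hNOpos` is
`BQPQTM_eq_BQP_of_pos` of `QuantumTuringProofs.lean` (the duplicate
`BQPQTM_eq_BQP_of_positioned` formerly in this file was removed in its favour).

No named fact is introduced.

## References

* H. Nishimura, M. Ozawa, *Computational complexity of uniform quantum circuit families and
  quantum Turing machines*, Theoret. Comput. Sci. 276 (2002) 147–181 [NishimuraOzawa2002]:
  Lemma 5.1, Thm. 5.2.
* E. Bernstein, U. Vazirani, *Quantum complexity theory*, SIAM J. Comput. 26 (1997) 1411–1473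
  [BernsteinVaziraniSICOMP1997]: Def. 3.2–3.4, Thm. 4.3, App. B Def. B.5, Thm. 8.3.
-/

namespace Literature.Computability.QuantumComplexity

open Cryptography Complexity

/-- **`BQP ⊆ BQPQTM` and `BQP ⊆ BQPQTMPos` from a positioned, head-oblivious simulation lemma**
(Nishimura–Ozawa 2002, Lemma 5.1 and Thm. 5.2, inclusion `BUPQC ⊆ BQP`, in Bernstein–Vazirani's
model). `hNOpos`: every polynomial-time uniform, oracle-free Clifford+T family `F` is carried out
by a Bernstein–Vazirani well-formed QTM `M` with polynomial-time computable amplitudes, observed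
at a polynomial time `q(|x|)` at which all configurations with non-zero amplitude have the same
head position, with positioned acceptance probability `F.acceptProbOn 0 x`. Head-obliviousness
makes the tree's acceptance probability equal to the positioned one
(`QTM.acceptProbAt_eq_pacceptProbAt`), and BV well-formedness implies the tree's
(`QTM.isWellFormed_of_pIsWellFormed`): the tree inclusion is `BQP_subset_BQPQTM_of_pos`, the
positioned one `BQP_subset_BQPQTMPos_of`. For the equality `BQPQTM_eq_BQP` use
`BQPQTM_eq_BQP_of_pos`. [cite: NishimuraOzawa2002, Lemma 5.1 and Thm. 5.2] -/
theorem BQP_subset_BQPQTM_of_positioned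
    (hNOpos : ∀ F : QCircuitFamily cliffordT, F.IsOracleFree → F.IsUniform →
      ∃ (M : QTM) (q : Polynomial ℕ), M.PIsWellFormed ∧
        M.amplitudes ⊆ polyTimeComputableComplex ∧
          (∀ x : List Bool, ∃ ξ : ℤ,
            ∀ c ∈ (M.pstateAt x (q.eval x.length)).support, c.2 = ξ) ∧
          ∀ x : List Bool, M.pacceptProbAt x (q.eval x.length) = F.acceptProbOn 0 x) :
    BQP ⊆ BQPQTM ∧ BQP ⊆ BQPQTMPos := by
  refine ⟨BQP_subset_BQPQTM_of_pos hNOpos, BQP_subset_BQPQTMPos_of fun F hfree hU => ?_⟩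
  obtain ⟨M, q, hwf, hamp, -, hacc⟩ := hNOpos F hfree hU
  exact ⟨M, q, hwf, hamp, hacc⟩

end Literature.Computability.QuantumComplexity
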